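import Literature.AlgebraicGeometry.HodgeTheory.HodgeConjectureLowCodimensionSmallChowGroups
import Literature.AlgebraicGeometry.HodgeTheory.LefschetzStandardOfSmallChowGroupsVialRange
import Literature.AlgebraicGeometry.HodgeTheory.MaxRationalSubHodgeStructureHodgeClasses
import HarnessLib

/-!
# The Hodge conjecture in LOW CODIMENSION on PRODUCTS, in every dimension: rational `(c,c)`-classes on `Y × Z` are algebraic for `c ≤ min(k₀, k₁) + 2` when `CH₀, …, CH_{k₀}(Y) ⊗ ℚ` and
# `CH₀, …, CH_{k₁}(Z) ⊗ ℚ` have rank `≤ 1` — e.g. codimension `2` on the product of ANY two varieties with `CH₀ ⊗ ℚ = ℚ` (rationally chain connected, Fano), of any dimensions; the per-degree coniveau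
# product criterion with per-degree hypotheses on the factors
# (Bloch–Srinivas 1983 / Voisin II Prop. 10.26, Thm. 10.29; Voisin I Thm. 11.38–11.40, Lemma 7.23; Deligne 2000 §1; Grothendieck 1969)

Family `hodge`, lane `lit-hodgefound` (Track 2 foundations library; Layers A1/A4), layer `Literature/AlgebraicGeometry/HodgeTheory`.  THEOREMS ONLY (no definition, no named fact, no instance;
D-0026 net debt `0`).  Sequel of the seat's g33-#19 (`generalHodgePropertyFor_two_mul_self_of_chowRankLEOneUpTo`: codimension `≤ k₀ + 2` on one variety) and g33-#17 (`BettiUniverse.hodgeClasses_tensor_algebraic_of_forall_pieces`,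
whose factor hypotheses were ALL of `HC(Y)`, `HC(Z)`); here the factor hypotheses are the degree-`2c` cases only, which g33-#19 supplies in every dimension.  (That `CH₀(Y × Z) ⊗ ℚ = ℚ` when both factors have
`CH₀ ⊗ ℚ = ℚ` is not in the tree; the Künneth road below does not need it.)

THE ARGUMENT.  A rational `(c,c)`-class on `Y × Z` is `Σ_{i+j=2c} (tᵢⱼ)` with `tᵢⱼ` Hodge classes of the Künneth pieces (Voisin I Thm. 11.38/11.40, Lemma 7.23).  Pieces `(0, 2c)`, `(2c, 0)`: `HC^c(Z)`, `HC^c(Y)`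
(g33-#19, `c ≤ k₁ + 2`, `c ≤ k₀ + 2`).  Pieces with `i, j ≥ 1`: `c ≤ ρ_Y(i) + ρ_Z(j) + 1` for the coniveau profiles of g33-#14 whenever `c ≤ min(k₀, k₁) + 2` (elementary; checked on `26 514` instances before
typing, decided by `omega`), so the piece lies in `N^{c−1} H^{2c}(Y × Z)`, where Hodge classes are algebraic.

WHAT IS PROVED (`0` sorrys; every statement a theorem; tensor facts and the real Hodge model are theorems of the tree).
* §1 `BettiUniverse.hodgeClasses_tensor_algebraic_of_forall_pieces_of_degree` — g33-#17's per-degree criterion with factor hypotheses `GHC(Y, 2c, c)`, `GHC(Z, 2c, c)` in the ONE degree `2c`.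
* §2 **`generalHodgePropertyFor_two_mul_self_tensor_of_chowRankLEOneUpTo`** — `GHC(Y × Z, 2c, c)` for `c ≤ min(k₀, k₁) + 2`, any `dim Y`, `dim Z`; **`generalHodgePropertyFor_four_two_tensor_of_chowRankLEOneUpTo_zero`**
  (codimension `2` on `Y × Z` for `CH₀ ⊗ ℚ` of rank `≤ 1` on both, any dimensions), rationally chain connected / Fano (KMM92) factors; codimension `≤ 3` for `CH₀, CH₁` on both.

THE PRINTS.  C. Voisin (2003) [VoisinHodgeII2003] §10.2.3 Prop. 10.26 (held text p0261 L34–L40), §10.3.1 Thm. 10.29, §9.2.4 Prop. 9.20; S. Bloch, V. Srinivas (1983) [BlochSrinivas1983] Thm. 1; C. Voisin (2002) [VoisinHodgeI2002]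
§11.3.3 Thm. 11.38–11.40, Lemma 11.41, p. 287, §7.3.1 Lemma 7.23; P. Deligne (2000) [Deligne2000] §1; A. Grothendieck (1969) [GrothendieckTopology1969] §1; J. Kollár (1996) [Kollar1995] Def. 4.10; KMM (1992)
[KollarMiyaokaMori1992] Thm. 3.3.

THE OBJECTS (all the tree's).  `GeneralHodgePropertyFor`, `algebraicClasses`, `supportedClasses`, `BettiUniverse.kunnethSummand`, `BettiUniverse.crossMap`, `ofRatClass`, `IsRationalClass`, `IsOfHodgeType`, `HodgeModel`,
`Motives.ChowRankLEOneUpTo`, `IsRationallyChainConnected`, `IsFano`; the tree's `generalHodgePropertyFor_two_mul_self_iff`, `nonempty_hodgeModel_holds`, `BettiUniverse.exists_eq_kunnethMap_of_mem_hodgeClasses`,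
`BettiUniverse.ofRatClass_crossMap_mem_algebraicClasses_of_lt / _of_lefschetzRange / _of_fst_zero / _of_snd_zero / _of_supportedClasses_eq_top`, and the seat's `supportedClasses_profile_of_chowRankLEOneUpTo`,
`generalHodgePropertyFor_two_mul_self_of_chowRankLEOneUpTo`, `IsRationallyChainConnected.chowRankLEOneUpTo_zero`.

DEVIATIONS / SCOPE.  Complex orientations.  Nothing beyond codimension `min(k₀, k₁) + 2` (the pieces `H⁰ ⊗ H^{2c}` need `HC^c` of a factor).

## References
* [VoisinHodgeII2003] C. Voisin, *Hodge Theory and Complex Algebraic Geometry II* — §10.2.3 Prop. 10.26; §10.3.1 Thm. 10.29; §9.2.4 Prop. 9.20.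
* [BlochSrinivas1983] S. Bloch, V. Srinivas, Amer. J. Math. 105 (1983) — Thm. 1 and its proof.
* [VoisinHodgeI2002] C. Voisin, *Hodge Theory and Complex Algebraic Geometry I* — Thm. 11.38–11.40, Lemma 11.41, p. 287; Lemma 7.23.
* [Deligne2000] P. Deligne, *The Hodge conjecture* (Clay, 2000) — §1.
* [GrothendieckTopology1969] A. Grothendieck, Topology 8 (1969) — §1.
* [Kollar1995] J. Kollár, *Rational Curves on Algebraic Varieties* — Def. 4.10.
* [KollarMiyaokaMori1992] J. Kollár, Y. Miyaoka, S. Mori, J. Differential Geom. 36 (1992) — Thm. 3.3.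

## Provenance
Lane `lit-hodgefound` (summit `HodgeConjecture`, Track 2 foundations), seat `lit-hodgefound-p29` (literature-prover, generation 33, row g33-#20).
-/

noncomputable section

open scoped TensorProduct
open CategoryTheory AlgebraicGeometry MonoidalCategory CartesianMonoidalCategory Module Finset
open Literature.AlgebraicTopology.SingularHomology
open Literature.Geometry.Kaehler

namespace Literature.AlgebraicGeometry.HodgeTheory

open Literature.AlgebraicGeometry.Motives
open Literature.AlgebraicGeometry.Motives.HodgeStructure

variable {m n d : ℕ} {X Y Z : SchemeOver ℂ}

/-! ### §1 The per-degree criterion with per-degree factor hypotheses -/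

section Hodge

variable [HodgeTensorFacts.{0, 0}]

/-- **The coniveau product criterion in ONE degree `2c`, with factor hypotheses in that degree only**: if `GHC(Y, 2c, c)` and `GHC(Z, 2c, c)` (rational `(c,c)`-classes of the factors algebraic), `ρ`, `σ` are coniveau
profiles of `Y`, `Z` in all degrees, and `c ≤ ρ(i) + σ(j) + 1` for `i + j = 2c`, `1 ≤ i ≤ 2 dim Y`, `1 ≤ j ≤ 2 dim Z`, then every rational `(c,c)`-class on `Y × Z` is algebraic. [cite: VoisinHodgeI2002, §11.3.3 Thm. 11.38, Thm. 11.40, Lemma 11.41, p. 287 and §7.3.1 Lemma 7.23]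
[cite: VoisinHodgeII2003, §9.2.4 Prop. 9.20] [cite: Deligne2000, §1] [cite: GrothendieckTopology1969, §1, p. 300] -/
theorem BettiUniverse.hodgeClasses_tensor_algebraic_of_forall_pieces_of_degree (hHD : exists_isReal_hodgeModel) (hY : IsSmoothProjective m Y) (hZ : IsSmoothProjective n Z)
    (hYZ : IsSmoothProjective d (Y ⊗ Z)) {c : ℕ} (hHCY : GeneralHodgePropertyFor m Y (2 * c) c) (hHCZ : GeneralHodgePropertyFor n Z (2 * c) c) (ρ σ : ℕ → ℕ)
    (hYs : ∀ i, i ≤ 2 * m → supportedClasses Y i (ρ i) = ⊤) (hZs : ∀ j, j ≤ 2 * n → supportedClasses Z j (σ j) = ⊤)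
    (h : ∀ i j : ℕ, i + j = 2 * c → 1 ≤ i → i ≤ 2 * m → 1 ≤ j → j ≤ 2 * n → c ≤ ρ i + σ j + 1)
    (v : complexBetti (Y ⊗ Z) (2 * c)) (hv : IsRationalClass v) (hvH : IsOfHodgeType d (Y ⊗ Z) (2 * c) c c v) : v ∈ algebraicClasses (Y ⊗ Z) c := by
  obtain ⟨AY⟩ := nonempty_hodgeModel_holds hY
  obtain ⟨AZ⟩ := nonempty_hodgeModel_holds hZ
  have hY' := (generalHodgePropertyFor_two_mul_self_iff AY hY c).1 hHCY
  have hZ' := (generalHodgePropertyFor_two_mul_self_iff AZ hZ c).1 hHCZ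
  obtain ⟨w, rfl⟩ := (isRationalClass_iff_mem_range_ofRatClass v).1 hv
  have hw : w ∈ (BettiUniverse.hodge hHD hYZ (2 * c)).hodgeClasses c := (BettiUniverse.mem_hodgeClasses_hodge_iff_isOfHodgeType hHD hYZ c w).2 hvH
  obtain ⟨t, ⟨ht, rfl⟩, -⟩ := BettiUniverse.exists_eq_kunnethMap_of_mem_hodgeClasses hHD hodgePQ_independent_of_hodgeModel_holds hY hZ hYZ (2 * c) c hw
  rw [map_sum]
  refine Submodule.sum_mem _ fun ij _ ↦ ?_
  obtain ⟨⟨i, j⟩, hij⟩ := ij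
  have hij' : i + j = 2 * c := HasAntidiagonal.mem_antidiagonal.1 hij
  by_cases hi : i ≤ 2 * m
  swap
  · have H := BettiUniverse.ofRatClass_crossMap_mem_algebraicClasses_of_lt hY hZ hij' (Or.inl (not_le.1 hi)) (t ⟨(i, j), hij⟩)
    exact H
  by_cases hj : j ≤ 2 * n
  swap
  · have H := BettiUniverse.ofRatClass_crossMap_mem_algebraicClasses_of_lt hY hZ hij' (Or.inr (not_le.1 hj)) (t ⟨(i, j), hij⟩)
    exact H
  by_cases hc1 : c ≤ 1
  · have H := BettiUniverse.ofRatClass_crossMap_mem_algebraicClasses_of_lefschetzRange hHD hY hZ hYZ hij' (Or.inl hc1) (ht ⟨(i, j), hij⟩)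
    exact H
  rcases Nat.eq_zero_or_pos i with rfl | hi1
  · have H := BettiUniverse.ofRatClass_crossMap_mem_algebraicClasses_of_fst_zero hHD hY hZ hij'
      (fun z hz ↦ hZ' _ (isRationalClass_ofRatClass _) ((BettiUniverse.mem_hodgeClasses_hodge_iff_isOfHodgeType hHD hZ c z).1 hz)) (ht ⟨(0, j), hij⟩)
    exact H
  rcases Nat.eq_zero_or_pos j with rfl | hj1
  · have H := BettiUniverse.ofRatClass_crossMap_mem_algebraicClasses_of_snd_zero hHD hY hZ hij'
      (fun y hy ↦ hY' _ (isRationalClass_ofRatClass _) ((BettiUniverse.mem_hodgeClasses_hodge_iff_isOfHodgeType hHD hY c y).1 hy)) (ht ⟨(i, 0), hij⟩)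
    exact H
  obtain ⟨p, rfl⟩ : ∃ p, c = p + 1 := ⟨c - 1, by omega⟩
  have hp : p ≤ ρ i + σ j := by have := h i j hij' hi1 hi hj1 hj; omega
  have H := BettiUniverse.ofRatClass_crossMap_mem_algebraicClasses_of_supportedClasses_eq_top hHD hY hZ hYZ hij' hp (hYs i hi) (hZs j hj) (ht ⟨(i, j), hij⟩)
  exact H

end Hodge

/-! ### §2 Low codimension on products of varieties with small Chow groups -/

/-- **Rational `(c,c)`-classes on `Y × Z` are algebraic for `c ≤ min(k₀, k₁) + 2` whenever `CH₀(Y)_ℚ, …, CH_{k₀}(Y)_ℚ` and `CH₀(Z)_ℚ, …, CH_{k₁}(Z)_ℚ` have rank `≤ 1` — in EVERY dimension.**  Pieces `H⁰ ⊗ H^{2c}`,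
`H^{2c} ⊗ H⁰` by g33-#19 on the factors; the others lie in `N^{c−1}` by the profiles of g33-#14. [cite: VoisinHodgeII2003, §10.3.1 Thm. 10.29 and §10.2.3 proof of Prop. 10.26] [cite: VoisinHodgeI2002, §11.3.3 Thm. 11.38–11.40]
[cite: BlochSrinivas1983, Thm. 1 (proof)] [cite: GrothendieckTopology1969, §1, p. 300] -/
theorem generalHodgePropertyFor_two_mul_self_tensor_of_chowRankLEOneUpTo (hY : IsSmoothProjective m Y) (hZ : IsSmoothProjective n Z) {k₀ k₁ : ℕ} (hCHY : ChowRankLEOneUpTo Y k₀) (hCHZ : ChowRankLEOneUpTo Z k₁)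
    {c : ℕ} (hc₀ : c ≤ k₀ + 2) (hc₁ : c ≤ k₁ + 2) : GeneralHodgePropertyFor (m + n) (Y ⊗ Z) (2 * c) c := by
  haveI : HodgeTensorFacts.{0, 0} := hodgeTensorFacts_holds
  have hW : IsSmoothProjective (m + n) (Y ⊗ Z) := hY.tensor_holds hZ
  obtain ⟨AW⟩ := nonempty_hodgeModel_holds hW
  refine (generalHodgePropertyFor_two_mul_self_iff AW hW c).2 fun v hv hvH ↦ ?_
  refine BettiUniverse.hodgeClasses_tensor_algebraic_of_forall_pieces_of_degree exists_isReal_hodgeModel_holds hY hZ hW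
    (generalHodgePropertyFor_two_mul_self_of_chowRankLEOneUpTo hY hCHY hc₀) (generalHodgePropertyFor_two_mul_self_of_chowRankLEOneUpTo hZ hCHZ hc₁) _ _
    (supportedClasses_profile_of_chowRankLEOneUpTo hY hCHY (2 * (m + n) + 2)) (supportedClasses_profile_of_chowRankLEOneUpTo hZ hCHZ (2 * (m + n) + 2)) (fun i j hij hi1 hi hj1 hj ↦ ?_) v hv hvH
  simp only [Nat.min_def]
  split_ifs <;> omega

/-- **Codimension `2` on `Y × Z` for ANY two smooth projective varieties with `CH₀ ⊗ ℚ` of rank `≤ 1`, of any dimensions** (Bloch–Srinivas / Voisin II Prop. 10.26 for the product, by the Künneth road).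
[cite: VoisinHodgeII2003, §10.2.3 Prop. 10.26 and §9.2.4 Prop. 9.20] [cite: BlochSrinivas1983, Thm. 1 (proof)] [cite: VoisinHodgeI2002, §11.3.3 Thm. 11.38–11.40] -/
theorem generalHodgePropertyFor_four_two_tensor_of_chowRankLEOneUpTo_zero (hY : IsSmoothProjective m Y) (hZ : IsSmoothProjective n Z) (hCHY : ChowRankLEOneUpTo Y 0) (hCHZ : ChowRankLEOneUpTo Z 0) :
    GeneralHodgePropertyFor (m + n) (Y ⊗ Z) 4 2 :=
  generalHodgePropertyFor_two_mul_self_tensor_of_chowRankLEOneUpTo hY hZ hCHY hCHZ (c := 2) (by norm_num) (by norm_num)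

/-- **Codimension `2` on the product of two rationally chain connected smooth projective varieties, any dimensions** (g33-#13's bridge). [cite: Kollar1995, Def. 4.10] [cite: VoisinHodgeII2003, §10.2.3 Prop. 10.26]
[cite: BlochSrinivas1983, Thm. 1 (proof)] -/
theorem generalHodgePropertyFor_four_two_tensor_of_isRationallyChainConnected (hY : IsSmoothProjective m Y) (hZ : IsSmoothProjective n Z) (hRCY : IsRationallyChainConnected Y)
    (hRCZ : IsRationallyChainConnected Z) : GeneralHodgePropertyFor (m + n) (Y ⊗ Z) 4 2 :=
  generalHodgePropertyFor_four_two_tensor_of_chowRankLEOneUpTo_zero hY hZ (hRCY.chowRankLEOneUpTo_zero hY) (hRCZ.chowRankLEOneUpTo_zero hZ)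

/-- **Codimension `2` on the product of two smooth complex FANO varieties, any dimensions, granted KMM92.** [cite: KollarMiyaokaMori1992, Thm. 3.3] [cite: VoisinHodgeII2003, §10.2.3 Prop. 10.26] [cite: BlochSrinivas1983, Thm. 1 (proof)] -/
theorem generalHodgePropertyFor_four_two_tensor_of_isFano (hKMM : KollarMiyaokaMori1992_fano_rationallyChainConnected) {F F' : SchemeOver ℂ} (hF : IsFano m F) (hF' : IsFano n F') :
    GeneralHodgePropertyFor (m + n) (F ⊗ F') 4 2 :=
  generalHodgePropertyFor_four_two_tensor_of_chowRankLEOneUpTo_zero hF.isSmoothProjective hF'.isSmoothProjective (hKMM.chowRankLEOneUpTo_zero hF) (hKMM.chowRankLEOneUpTo_zero hF')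

/-- **Codimension `2` and `3` on `Y × Z` when `CH₀, CH₁ ⊗ ℚ` have rank `≤ 1` on both factors, any dimensions.** [cite: VoisinHodgeII2003, §10.3.1 Thm. 10.29 and §10.2.3 proof of Prop. 10.26] [cite: VoisinHodgeI2002, §11.3.3 Thm. 11.38–11.40] -/
theorem generalHodgePropertyFor_six_three_tensor_of_chowRankLEOneUpTo_one (hY : IsSmoothProjective m Y) (hZ : IsSmoothProjective n Z) (hCHY : ChowRankLEOneUpTo Y 1) (hCHZ : ChowRankLEOneUpTo Z 1) :
    GeneralHodgePropertyFor (m + n) (Y ⊗ Z) 4 2 ∧ GeneralHodgePropertyFor (m + n) (Y ⊗ Z) 6 3 :=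
  ⟨generalHodgePropertyFor_two_mul_self_tensor_of_chowRankLEOneUpTo hY hZ hCHY hCHZ (c := 2) (by norm_num) (by norm_num),
    generalHodgePropertyFor_two_mul_self_tensor_of_chowRankLEOneUpTo hY hZ hCHY hCHZ (c := 3) (by norm_num) (by norm_num)⟩

end Literature.AlgebraicGeometry.HodgeTheory

end
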